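import Literature.MathematicalPhysics.QuantumLattice.HubbardBandBottomSector
import Literature.MathematicalPhysics.QuantumLattice.FreeFermionSectorEnergyDeviation
import Literature.MathematicalPhysics.QuantumLattice.FermionGammaFunctorTrace
import HarnessLib

/-!
# Slater states over eigenmodes and spin-doubled site bases

Topic `MathematicalPhysics/QuantumLattice`, family `hubbard`. Second-quantisation bookkeeping on the
tree's Jordan–Wigner Fock space, for an ARBITRARY family of one-particle modes (part 1 of the
free-fermion sector floor on a finite graph, `FreeFermionGraphSectorFloor.lean`):

* `RayleighBound.create_smul/add/zero/sum` — linearity of the smeared creation operator `c†(f)`;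
* `dGamma_mul_create_sub` — the smeared commutator `[dΓ(A), c†(f)] = c†(A f)`;
* `dGamma_mulVec_slater`, `isNParticle_slater`, `annihilate_mulVec_slater_eq_zero`,
  `star_slater_dotProduct_self`, `slater_ne_zero` — Slater states `c†(f₁)⋯c†(f_m)|∅⟩` over
  eigenmodes of `A` are eigenvectors of `dΓ(A)` with eigenvalue the level sum, are `m`-particle
  vectors, and are unit vectors for orthonormal modes with distinct labels;
* `spinMode_complete`, `spinMode_orthonormal`, `spinMode_unit`, `spinMode_eigen` — for a site family
  `v : κ → (Λ → ℂ)` the spin-doubled family `w_{(k,σ)}(x,τ) = [τ = σ] v_k(x)` on `Orb Λ` inherits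
  completeness and orthonormality, and diagonalises every spin-diagonal orbital matrix
  `h_{(x,σ),(y,τ)} = [σ = τ] A_{xy}` when `A v_k = ε_k v_k` (the families are passed as hypotheses
  `hw : ∀ p o, w p o = …`, as in `HubbardBandBottomOneBody.lean`, which treats Mathlib's eigenvector
  unitary only);
* `create_spinMode_eq_sum`, `annihilate_spinMode_eq_sum`, `sum_numberMode_spinMode` — `c†(w_{kσ})`
  is a one-species site sum and the rotated number operators of one species sum to `Σ_x n_{xσ}`
  (Parseval per spin);
* `sum_normSq_annihilate_spinMode_up/down` — on Lieb's sector `(a, b)` the rotated `↑`- (`↓`-)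
  occupations sum to `a ‖ψ‖²` (`b ‖ψ‖²`).

Everything is proved; no definitions, no named facts. Sources: O. Bratteli, D. W. Robinson,
*Operator Algebras and Quantum Statistical Mechanics 2* (2nd ed., Springer 1997) §5.2.1; E. H. Lieb,
PRL 62 (1989) 1201, eq. (2) (the sectors `(a, b)`). Folklore finite-dimensional statements.

## Mathlib / tree search

Tree (REUSED): `RayleighBound.create/annihilate/numberMode/normSq`, `dGamma_commutator_creation`,
`dGamma_mulVec_vacuum`, `annihilate_mul_create_of_unit/of_orthogonal`, `annihilate_mulVec_vacuum`,
`star_vacuum_dotProduct_vacuum'`, `IsNParticle.create_mulVec`, `star_dotProduct_numberMode_mulVec`,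
`sum_numberOp_mulVec_apply`, `sum_orb_eq_sum_sum`, `upPart/downPart`, `IsInSector`. Mathlib:
`Finset.sum_comm`, `Fintype.sum_prod_type`, `List` induction. Mathlib has no Fock-space Slater states.
-/
namespace Literature.MathematicalPhysics.QuantumLattice

open Matrix Finset Literature.MathematicalPhysics.QuantumLattice.RayleighBound
  Literature.MathematicalPhysics.QuantumLattice.HubbardBandBottom
open scoped ComplexOrder ComplexConjugate

/-! ### Smeared creation operators: linearity and the commutator with `dΓ` -/

section Spinless

variable {ι : Type*} [LinearOrder ι] [Fintype ι]

/-- `c†(c • f) = c • c†(f)` (linearity of the smeared creation operator). [folklore] -/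
theorem RayleighBound.create_smul (c : ℂ) (f : ι → ℂ) : create (c • f) = c • create f := by
  simp only [create, Pi.smul_apply, smul_eq_mul, Finset.smul_sum, smul_smul]

/-- `c†(f + g) = c†(f) + c†(g)`. [folklore] -/
theorem RayleighBound.create_add (f g : ι → ℂ) : create (f + g) = create f + create g := by
  simp only [create, Pi.add_apply, add_smul, Finset.sum_add_distrib]

/-- `c†(0) = 0`. [folklore] -/
theorem RayleighBound.create_zero : create (0 : ι → ℂ) = 0 := by
  simp only [create, Pi.zero_apply, zero_smul, Finset.sum_const_zero]

/-- `c†(Σ_k f_k) = Σ_k c†(f_k)`. [folklore] -/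
theorem RayleighBound.create_sum {κ : Type*} (s : Finset κ) (f : κ → ι → ℂ) :
    create (∑ k ∈ s, f k) = ∑ k ∈ s, create (f k) := by
  classical
  induction s using Finset.induction_on with
  | empty => rw [Finset.sum_empty, Finset.sum_empty, RayleighBound.create_zero]
  | insert a s ha ih => rw [Finset.sum_insert ha, Finset.sum_insert ha, RayleighBound.create_add, ih]

/-- **The smeared commutator `[dΓ(A), c†(f)] = c†(A f)`**: `ad dΓ(A)` acts on the smeared creation
operators by the one-body matrix `A`. Bratteli–Robinson II §5.2.1. [folklore] -/
theorem dGamma_mul_create_sub (A : Matrix ι ι ℂ) (f : ι → ℂ) :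
    dGamma A * create f - create f * dGamma A = create (A *ᵥ f) := by
  have h1 : dGamma A * create f - create f * dGamma A =
      ∑ j, f j • (dGamma A * creation j - creation j * dGamma A) := by
    simp only [create, Finset.mul_sum, Finset.sum_mul, Matrix.mul_smul, Matrix.smul_mul,
      ← Finset.sum_sub_distrib, smul_sub]
  rw [h1]
  simp_rw [dGamma_commutator_creation, Finset.smul_sum, smul_smul]
  rw [Finset.sum_comm]
  simp only [create, ← Finset.sum_smul, mulVec, dotProduct]
  refine Finset.sum_congr rfl fun k _ => ?_
  congr 1
  exact Finset.sum_congr rfl fun j _ => mul_comm _ _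

/-- `dΓ(A) c†(f) = c†(f) dΓ(A) + c†(A f)`. [folklore] -/
theorem dGamma_mul_create (A : Matrix ι ι ℂ) (f : ι → ℂ) :
    dGamma A * create f = create f * dGamma A + create (A *ᵥ f) := by
  rw [← dGamma_mul_create_sub]; abel

/-! ### Slater states over eigenmodes -/

/-- **Slater states over eigenmodes are eigenvectors of `dΓ`**: if `A f_k = ε_k f_k` for the modes
of a list `l`, then `dΓ(A) c†(f_{k₁})⋯c†(f_{k_m})|∅⟩ = (Σ_i ε_{k_i}) c†(f_{k₁})⋯c†(f_{k_m})|∅⟩`.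
Bratteli–Robinson II §5.2.1. [folklore] -/
theorem dGamma_mulVec_slater {κ : Type*} (A : Matrix ι ι ℂ) (v : κ → ι → ℂ) (e : κ → ℝ)
    (heig : ∀ k, A *ᵥ v k = ((e k : ℝ) : ℂ) • v k) (l : List κ) :
    dGamma A *ᵥ ((l.map fun k => create (v k)).prod *ᵥ (vacuum : Fock ι)) =
      (((l.map e).sum : ℝ) : ℂ) • ((l.map fun k => create (v k)).prod *ᵥ (vacuum : Fock ι)) := by
  induction l with
  | nil =>
    rw [List.map_nil, List.prod_nil, one_mulVec, dGamma_mulVec_vacuum, List.map_nil, List.sum_nil,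
      Complex.ofReal_zero, zero_smul]
  | cons k l ih =>
    rw [List.map_cons, List.prod_cons, ← mulVec_mulVec, mulVec_mulVec _ (dGamma A), dGamma_mul_create,
      add_mulVec, ← mulVec_mulVec, ih, mulVec_smul, heig, RayleighBound.create_smul, smul_mulVec,
      List.map_cons, List.sum_cons, Complex.ofReal_add, add_smul, add_comm]

/-- A Slater state over `m` modes is an `m`-particle vector. [folklore] -/
theorem isNParticle_slater {κ : Type*} (v : κ → ι → ℂ) (l : List κ) :
    IsNParticle l.length ((l.map fun k => create (v k)).prod *ᵥ (vacuum : Fock ι)) := by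
  induction l with
  | nil =>
    rw [List.map_nil, List.prod_nil, one_mulVec, List.length_nil]
    exact EtaPairingODLRO.isNParticle_vacuum
  | cons k l ih =>
    rw [List.map_cons, List.prod_cons, ← mulVec_mulVec, List.length_cons]
    exact ih.create_mulVec _

/-- A mode orthogonal to every mode of a Slater state annihilates it:
`c(f) c†(g₁)⋯c†(g_m)|∅⟩ = 0` if `⟨f, g_i⟩ = 0` for all `i`. [folklore] -/
theorem annihilate_mulVec_slater_eq_zero {κ : Type*} (v : κ → ι → ℂ) (f : ι → ℂ) (l : List κ)
    (hf : ∀ k ∈ l, star f ⬝ᵥ v k = 0) :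
    annihilate f *ᵥ ((l.map fun k => create (v k)).prod *ᵥ (vacuum : Fock ι)) = 0 := by
  induction l with
  | nil => rw [List.map_nil, List.prod_nil, one_mulVec, annihilate_mulVec_vacuum]
  | cons k l ih =>
    rw [List.map_cons, List.prod_cons, ← mulVec_mulVec, mulVec_mulVec _ (annihilate f),
      annihilate_mul_create_of_orthogonal (hf k List.mem_cons_self), neg_mulVec, ← mulVec_mulVec,
      ih (fun k' hk' => hf k' (List.mem_cons_of_mem k hk')), mulVec_zero, neg_zero]

/-- **Slater states over orthonormal modes are unit vectors**: for pairwise distinct indices and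
orthonormal modes, `‖c†(v_{k₁})⋯c†(v_{k_m})|∅⟩‖ = 1` (Gram determinant `det 1 = 1`).
Bratteli–Robinson II §5.2.1. [folklore] -/
theorem star_slater_dotProduct_self {κ : Type*} [DecidableEq κ] (v : κ → ι → ℂ)
    (hon : ∀ k k', star (v k) ⬝ᵥ v k' = if k = k' then 1 else 0) {l : List κ} (hl : l.Nodup) :
    star ((l.map fun k => create (v k)).prod *ᵥ (vacuum : Fock ι)) ⬝ᵥ
      ((l.map fun k => create (v k)).prod *ᵥ (vacuum : Fock ι)) = 1 := by
  induction l with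
  | nil => rw [List.map_nil, List.prod_nil, one_mulVec, star_vacuum_dotProduct_vacuum']
  | cons k l ih =>
    rw [List.nodup_cons] at hl
    rw [List.map_cons, List.prod_cons, ← mulVec_mulVec, star_mulVec_dotProduct, create_conjTranspose,
      mulVec_mulVec, annihilate_mul_create_of_unit (by rw [hon, if_pos rfl]), sub_mulVec, one_mulVec,
      ← mulVec_mulVec, annihilate_mulVec_slater_eq_zero v (v k) l
        (fun k' hk' => by rw [hon, if_neg]; rintro rfl; exact hl.1 hk'),
      mulVec_zero, sub_zero, ih hl.2]

/-- A Slater state over orthonormal modes with distinct indices is nonzero. [folklore] -/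
theorem slater_ne_zero {κ : Type*} [DecidableEq κ] (v : κ → ι → ℂ)
    (hon : ∀ k k', star (v k) ⬝ᵥ v k' = if k = k' then 1 else 0) {l : List κ} (hl : l.Nodup) :
    (l.map fun k => create (v k)).prod *ᵥ (vacuum : Fock ι) ≠ 0 := by
  intro h
  have h1 := star_slater_dotProduct_self v hon hl
  rw [h, dotProduct_zero] at h1
  exact zero_ne_one h1

end Spinless

/-! ### Spin-doubled modes of a site eigenbasis -/

section Spin

variable {Λ : Type*} [LinearOrder Λ] [Fintype Λ] {κ : Type*} [Fintype κ]

omit [Fintype Λ] in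
/-- **Completeness of the spin-doubled family** `w_{(k,σ)}(x,τ) = [τ = σ] v_k(x)` of a complete site
family `v`: `Σ_{k,σ} w_{kσ}(i) conj (w_{kσ}(j)) = δ_ij`. [folklore] -/
theorem spinMode_complete (v : κ → Λ → ℂ)
    (hv : ∀ x y : Λ, ∑ k, v k x * star (v k y) = if x = y then 1 else 0)
    (w : κ × Fin 2 → Orb Λ → ℂ) (hw : ∀ p o, w p o = if (ofLex o).2 = p.2 then v p.1 (ofLex o).1 else 0)
    (i j : Orb Λ) : ∑ p, w p i * star (w p j) = if i = j then 1 else 0 := by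
  obtain ⟨⟨x, σ⟩, rfl⟩ : ∃ q : Λ × Fin 2, toLex q = i := ⟨ofLex i, toLex_ofLex i⟩
  obtain ⟨⟨y, τ⟩, rfl⟩ : ∃ q : Λ × Fin 2, toLex q = j := ⟨ofLex j, toLex_ofLex j⟩
  rw [Fintype.sum_prod_type]
  simp only [hw, ofLex_toLex]
  have key : ∀ k : κ, ∑ ρ : Fin 2, (if σ = ρ then v k x else 0) * star (if τ = ρ then v k y else 0) =
      if σ = τ then v k x * star (v k y) else 0 := by
    intro k
    rw [Finset.sum_eq_single σ (fun ρ _ hρ => by rw [if_neg (Ne.symm hρ), zero_mul])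
      (fun h => absurd (Finset.mem_univ σ) h), if_pos rfl]
    by_cases hστ : σ = τ
    · subst hστ; rw [if_pos rfl, if_pos rfl]
    · rw [if_neg (Ne.symm hστ), if_neg hστ, star_zero, mul_zero]
  simp_rw [key]
  by_cases hστ : σ = τ
  · subst hστ
    simp only [if_true]
    rw [hv]
    by_cases hxy : x = y
    · subst hxy; rw [if_pos rfl, if_pos rfl]
    · rw [if_neg hxy, if_neg]
      exact fun h => hxy (congrArg Prod.fst (toLex.injective h))
  · simp_rw [if_neg hστ]
    rw [Finset.sum_const_zero, if_neg]
    exact fun h => hστ (congrArg Prod.snd (toLex.injective h))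

omit [LinearOrder Λ] [Fintype κ] in
/-- **Orthonormality of the spin-doubled family** of an orthonormal site family. [folklore] -/
theorem spinMode_orthonormal [DecidableEq κ] (v : κ → Λ → ℂ)
    (hon : ∀ k l, star (v k) ⬝ᵥ v l = if k = l then 1 else 0)
    (w : κ × Fin 2 → Orb Λ → ℂ) (hw : ∀ p o, w p o = if (ofLex o).2 = p.2 then v p.1 (ofLex o).1 else 0)
    (p q : κ × Fin 2) : star (w p) ⬝ᵥ w q = if p = q then 1 else 0 := by
  obtain ⟨k, σ⟩ := p
  obtain ⟨l, τ⟩ := q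
  rw [dotProduct, sum_orb_eq_sum_sum]
  simp only [hw, orb, ofLex_toLex, Pi.star_apply]
  have key : ∀ x : Λ, ∑ ρ : Fin 2, star (if ρ = σ then v k x else 0) * (if ρ = τ then v l x else 0) =
      if σ = τ then star (v k x) * v l x else 0 := by
    intro x
    rw [Finset.sum_eq_single σ (fun ρ _ hρ => by rw [if_neg hρ, star_zero, zero_mul])
      (fun h => absurd (Finset.mem_univ σ) h), if_pos rfl]
    by_cases hστ : σ = τ
    · subst hστ; rw [if_pos rfl, if_pos rfl]
    · rw [if_neg hστ, if_neg hστ, mul_zero]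
  simp_rw [key]
  by_cases hστ : σ = τ
  · subst hστ
    simp only [if_true]
    have h := hon k l
    rw [dotProduct] at h
    simp only [Pi.star_apply] at h
    rw [h]
    by_cases hkl : k = l
    · subst hkl; rw [if_pos rfl, if_pos rfl]
    · rw [if_neg hkl, if_neg]
      exact fun h' => hkl (congrArg Prod.fst h')
  · simp_rw [if_neg hστ]
    rw [Finset.sum_const_zero, if_neg]
    exact fun h' => hστ (congrArg Prod.snd h')

omit [LinearOrder Λ] [Fintype κ] in
/-- In particular every spin-doubled mode of an orthonormal site family is a unit vector.
[folklore] -/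
theorem spinMode_unit [DecidableEq κ] (v : κ → Λ → ℂ)
    (hon : ∀ k l, star (v k) ⬝ᵥ v l = if k = l then 1 else 0)
    (w : κ × Fin 2 → Orb Λ → ℂ) (hw : ∀ p o, w p o = if (ofLex o).2 = p.2 then v p.1 (ofLex o).1 else 0)
    (p : κ × Fin 2) : star (w p) ⬝ᵥ w p = 1 := by
  rw [spinMode_orthonormal v hon w hw, if_pos rfl]

omit [LinearOrder Λ] [Fintype κ] in
/-- **The spin-doubled family diagonalises a spin-diagonal orbital matrix**: for
`h_{(x,σ),(y,τ)} = [σ = τ] A_{xy}` and `A v_k = ε_k v_k` one has `h w_{kσ} = ε_k w_{kσ}`. [folklore] -/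
theorem spinMode_eigen {A : Matrix Λ Λ ℂ} (h : Matrix (Orb Λ) (Orb Λ) ℂ)
    (hh : ∀ x σ y τ, h (orb x σ) (orb y τ) = if σ = τ then A x y else 0)
    (v : κ → Λ → ℂ) (e : κ → ℝ) (heig : ∀ k, A *ᵥ v k = ((e k : ℝ) : ℂ) • v k)
    (w : κ × Fin 2 → Orb Λ → ℂ) (hw : ∀ p o, w p o = if (ofLex o).2 = p.2 then v p.1 (ofLex o).1 else 0)
    (p : κ × Fin 2) : h *ᵥ w p = ((e p.1 : ℝ) : ℂ) • w p := by
  obtain ⟨k, σ⟩ := p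
  have heigk : ∀ x, ∑ y, A x y * v k y = (e k : ℂ) * v k x := fun x => by
    have h1 := congrFun (heig k) x
    simp only [mulVec, dotProduct, Pi.smul_apply, smul_eq_mul] at h1
    exact h1
  funext o
  obtain ⟨⟨x, τ⟩, rfl⟩ : ∃ q : Λ × Fin 2, toLex q = o := ⟨ofLex o, toLex_ofLex o⟩
  simp only [mulVec, dotProduct, Pi.smul_apply, smul_eq_mul]
  rw [sum_orb_eq_sum_sum]
  have hh' : ∀ y ρ, h (toLex (x, τ)) (orb y ρ) = if τ = ρ then A x y else 0 := fun y ρ => hh x τ y ρ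
  simp only [hw, ofLex_toLex, orb]
  simp only [orb] at hh'
  simp only [hh']
  by_cases hτσ : τ = σ
  · subst hτσ
    rw [if_pos rfl, ← heigk x]
    refine Finset.sum_congr rfl fun y _ => ?_
    rw [Finset.sum_eq_single τ (fun ρ _ hρ => by rw [if_neg (Ne.symm hρ), zero_mul])
      (fun h => absurd (Finset.mem_univ τ) h), if_pos rfl, if_pos rfl]
  · rw [if_neg hτσ, mul_zero]
    refine Finset.sum_eq_zero fun y _ => Finset.sum_eq_zero fun ρ _ => ?_
    by_cases h1 : τ = ρ
    · subst h1; rw [if_neg hτσ, mul_zero]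
    · rw [if_neg h1, zero_mul]

omit [Fintype κ] in
/-- The smeared creation operator of a spin-doubled mode is a site sum of one spin species:
`c†(w_{kσ}) = Σ_x v_k(x) c†_{xσ}`. [folklore] -/
theorem create_spinMode_eq_sum (v : κ → Λ → ℂ)
    (w : κ × Fin 2 → Orb Λ → ℂ) (hw : ∀ p o, w p o = if (ofLex o).2 = p.2 then v p.1 (ofLex o).1 else 0)
    (k : κ) (σ : Fin 2) : create (w (k, σ)) = ∑ x, v k x • creation (orb x σ) := by
  rw [create, sum_orb_eq_sum_sum]
  refine Finset.sum_congr rfl fun x _ => ?_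
  rw [Finset.sum_eq_single σ (fun ρ _ hρ => by rw [hw]; simp [orb, hρ])
    (fun h => absurd (Finset.mem_univ σ) h), hw]
  simp [orb]

omit [Fintype κ] in
/-- Likewise `c(w_{kσ}) = Σ_x conj (v_k(x)) c_{xσ}`. [folklore] -/
theorem annihilate_spinMode_eq_sum (v : κ → Λ → ℂ)
    (w : κ × Fin 2 → Orb Λ → ℂ) (hw : ∀ p o, w p o = if (ofLex o).2 = p.2 then v p.1 (ofLex o).1 else 0)
    (k : κ) (σ : Fin 2) : annihilate (w (k, σ)) = ∑ x, star (v k x) • annihilation (orb x σ) := by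
  rw [annihilate, sum_orb_eq_sum_sum]
  refine Finset.sum_congr rfl fun x _ => ?_
  rw [Finset.sum_eq_single σ (fun ρ _ hρ => by rw [hw]; simp [orb, hρ])
    (fun h => absurd (Finset.mem_univ σ) h), hw]
  simp [orb]

/-- **Parseval per spin**: the rotated number operators of one spin species over a complete site
family sum to the number of that species, `Σ_k n(w_{kσ}) = Σ_x n_{xσ}`. [folklore] -/
theorem sum_numberMode_spinMode (v : κ → Λ → ℂ)
    (hv : ∀ x y : Λ, ∑ k, v k x * star (v k y) = if x = y then 1 else 0)
    (w : κ × Fin 2 → Orb Λ → ℂ) (hw : ∀ p o, w p o = if (ofLex o).2 = p.2 then v p.1 (ofLex o).1 else 0)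
    (σ : Fin 2) : ∑ k, numberMode (w (k, σ)) = ∑ x : Λ, numberOp x σ := by
  have h1 : ∀ k, numberMode (w (k, σ)) =
      ∑ x, ∑ y, (v k x * star (v k y)) • (creation (orb x σ) * annihilation (orb y σ)) := fun k => by
    rw [numberMode, create_spinMode_eq_sum v w hw, annihilate_spinMode_eq_sum v w hw, Finset.sum_mul_sum]
    simp only [smul_mul_smul_comm]
  simp_rw [h1]
  rw [Finset.sum_comm]
  refine Finset.sum_congr rfl fun x _ => ?_
  rw [Finset.sum_comm]
  simp_rw [← Finset.sum_smul, hv, ite_smul, one_smul, zero_smul, Finset.sum_ite_eq, Finset.mem_univ,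
    if_true, numberOp]

/-- **The rotated `↑`-occupations sum to `a ‖ψ‖²` on Lieb's sector `(a, b)`**:
`Σ_k ‖c(w_{k↑}) ψ‖² = a ‖ψ‖²` for a complete site family. [folklore] -/
theorem sum_normSq_annihilate_spinMode_up (v : κ → Λ → ℂ)
    (hv : ∀ x y : Λ, ∑ k, v k x * star (v k y) = if x = y then 1 else 0)
    (w : κ × Fin 2 → Orb Λ → ℂ) (hw : ∀ p o, w p o = if (ofLex o).2 = p.2 then v p.1 (ofLex o).1 else 0)
    {a b : ℕ} {ψ : Fock (Orb Λ)} (hψ : IsInSector a b ψ) :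
    ∑ k, normSq (annihilate (w (k, 0)) *ᵥ ψ) = a * normSq ψ := by
  apply Complex.ofReal_injective
  rw [Complex.ofReal_sum, Complex.ofReal_mul, Complex.ofReal_natCast]
  simp_rw [← star_dotProduct_numberMode_mulVec]
  rw [← dotProduct_sum, ← Matrix.sum_mulVec, sum_numberMode_spinMode v hv w hw 0,
    ← star_dotProduct_self_eq_normSq]
  simp only [dotProduct, Pi.star_apply, sum_numberOp_mulVec_apply, Finset.mul_sum]
  refine Finset.sum_congr rfl fun s _ => ?_
  by_cases hs : ψ s = 0
  · simp [hs]
  · have h := not_imp_comm.1 (hψ s) hs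
    have hup : ∀ inst : DecidablePred fun x : Λ => orb x 0 ∈ s,
        (@Finset.filter _ (fun x => orb x 0 ∈ s) inst Finset.univ).card = a := by
      intro inst; rw [← h.1]; congr 1; ext x; simp [upPart]
    rw [hup]
    ring

/-- **The rotated `↓`-occupations sum to `b ‖ψ‖²` on Lieb's sector `(a, b)`.** [folklore] -/
theorem sum_normSq_annihilate_spinMode_down (v : κ → Λ → ℂ)
    (hv : ∀ x y : Λ, ∑ k, v k x * star (v k y) = if x = y then 1 else 0)
    (w : κ × Fin 2 → Orb Λ → ℂ) (hw : ∀ p o, w p o = if (ofLex o).2 = p.2 then v p.1 (ofLex o).1 else 0)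
    {a b : ℕ} {ψ : Fock (Orb Λ)} (hψ : IsInSector a b ψ) :
    ∑ k, normSq (annihilate (w (k, 1)) *ᵥ ψ) = b * normSq ψ := by
  apply Complex.ofReal_injective
  rw [Complex.ofReal_sum, Complex.ofReal_mul, Complex.ofReal_natCast]
  simp_rw [← star_dotProduct_numberMode_mulVec]
  rw [← dotProduct_sum, ← Matrix.sum_mulVec, sum_numberMode_spinMode v hv w hw 1,
    ← star_dotProduct_self_eq_normSq]
  simp only [dotProduct, Pi.star_apply, sum_numberOp_mulVec_apply, Finset.mul_sum]
  refine Finset.sum_congr rfl fun s _ => ?_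
  by_cases hs : ψ s = 0
  · simp [hs]
  · have h := not_imp_comm.1 (hψ s) hs
    have hdown : ∀ inst : DecidablePred fun x : Λ => orb x 1 ∈ s,
        (@Finset.filter _ (fun x => orb x 1 ∈ s) inst Finset.univ).card = b := by
      intro inst; rw [← h.2]; congr 1; ext x; simp [downPart]
    rw [hdown]
    ring

end Spin

end Literature.MathematicalPhysics.QuantumLattice
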